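import Summits.ValiantsHypothesis.ValiantsHypothesis.Theorems.BarrierLeverChowBenchmarkPairsZeroOne

/-!
# Route BarrierLever — item 22038 `ChowBenchmarkPairs`, line `moore-peel`: a NO-GO for 0/1 designs —
# two parallel edges of the cube make the segment-moment matrix SINGULAR

Helper file (`--supports stmt-ValiantsHypothesis-22038`; cell valiant-natproofs, rung V4, 𝒟-side benchmark of
record; seat val-np-p4 gen 19; companion of `…ChowBenchmarkPairsZeroOne` (p626042) and of the memo
HOME/val-np-p4/g19/MEMO-zero-one-designs-valnp4-g19.md §9 "local relations").  Closes NO item.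

THE RULE.  In a 0/1 design `P = zoTable σ` (point `a` = indicator of `σ a`) suppose two DIFFERENT pairs of points are
edges of the cube in the SAME direction `u`: `σ x' = σ x ∪ {u}`, `σ b' = σ b ∪ {u}` with `u ∉ σ x`, `u ∉ σ b`
(`x, x', b, b'` four points, `{x,x'} ≠ {b,b'}`).  Then the four pair rows satisfy the universal linear relation
`row{x,b} + row{x',b'} = row{x,b'} + row{x',b}`, so the segment-moment matrix at `zoTable σ` is singular for EVERY
height and every enumeration of the rows (`det_zoTable_eq_zero_of_parallel_edges`).  In the zeon algebra this is the
one-line identity `(R_{x'} − R_x)(R_{b'} − R_b) = λμ·y_u²·R_x²R_b² = 0` (`R_{x+λe_u} = R_x + λ y_u R_x²`); entrywise,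
with the closed form `segSum_pair_zoTable`, it is exactly Pascal's rule `betaSum p q (m+1) = betaSum p (q+1) m +
betaSum (p+1) q m` (`betaSum_succ`) on the columns `T ∋ u`, and a tautology on the columns `T ∌ u`
(`zoPairEntry_parallel`).

WHY IT MATTERS (memo §9): this is the `|Q| = 1` member of a family of LOCAL relations `(R_X − R_Y)(R_B − R_C) = 0`
(e.g. on a 2-face `{u,v}`: an "aligned" pair `X, X+e_u+e_v` together with an "anti-aligned" pair `Z+e_u, Z+e_v`;
on a non-face `{u,v}` of `W_h`: any two pairs differing only inside `{u,v}`), which explain why product designs,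
Hamming balls and most RANDOM 0/1 families are singular (random families are nonsingular only ≈ 1 % of the time,
kit j306710, although rank hill-climbing finds a nonsingular one for every h ≤ 32, kit j306146): a design for
CONJECTURE Z01 (`Stmt.stub_zeroOneDesign`) must in particular contain AT MOST ONE edge in each coordinate direction.

WHAT THIS IS NOT: a constraint on 0/1 witnesses only (general point tables escape it: the relation needs two point
differences parallel to the same axis); no stub of the line is closed; nothing on items 20172 / 19717, crux
stmt-ValiantsHypothesis-14610, or `VP` versus `VNP`.
-/

set_option linter.dupNamespace false

namespace Summit.ValiantsHypothesis.ValiantsHypothesis.Theorems.BarrierLever.ChowBenchmarkZeroOne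

open Finset
open Summit.ValiantsHypothesis.ValiantsHypothesis.Theorems.BarrierLever.MoorePeel (benchCols)

variable {h : ℕ}

/-! ## 1. The pair entry as a function of the two supports, and the parallel-edge identity -/

/-- The 0/1 pair entry as a function of the two supports `A = σ a`, `B = σ b` and the column `T`:
`[T ⊆ A ∪ B] · betaSum |T ∖ B| |T ∖ A| |T ∩ A ∩ B|`. -/
def zoPairEntry (A B T : Finset (Fin h)) : ℕ :=
  if T ⊆ A ∪ B then betaSum (T \ B).card (T \ A).card (T ∩ A ∩ B).card else 0

/-- **The parallel-edge identity.**  For `u ∉ A`, `u ∉ B`: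
`E(A,B) + E(A+u,B+u) = E(A,B+u) + E(A+u,B)` at every column `T`. -/
theorem zoPairEntry_parallel (A B T : Finset (Fin h)) (u : Fin h) (huA : u ∉ A) (huB : u ∉ B) :
    zoPairEntry A B T + zoPairEntry (insert u A) (insert u B) T =
      zoPairEntry A (insert u B) T + zoPairEntry (insert u A) B T := by
  classical
  unfold zoPairEntry
  by_cases huT : u ∈ T
  · -- write `T = insert u T₀` with `u ∉ T₀`
    obtain ⟨T₀, huT₀, rfl⟩ : ∃ T₀ : Finset (Fin h), u ∉ T₀ ∧ T = insert u T₀ :=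
      ⟨T.erase u, Finset.notMem_erase u T, (Finset.insert_erase huT).symm⟩
    -- the first entry vanishes: `u ∈ T` but `u ∉ A ∪ B`
    have h0 : ¬ (insert u T₀ ⊆ A ∪ B) := fun hs =>
      (by simpa [Finset.mem_union, huA, huB] using hs (Finset.mem_insert_self u T₀))
    rw [if_neg h0, zero_add]
    -- the three other containment conditions are all `T₀ ⊆ A ∪ B`
    have c1 : (insert u T₀ ⊆ insert u A ∪ insert u B) ↔ T₀ ⊆ A ∪ B := by
      constructor
      · intro hs c hc
        have := hs (Finset.mem_insert_of_mem hc)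
        simp only [Finset.mem_union, Finset.mem_insert] at this
        rcases this with (rfl | hA) | (rfl | hB)
        · exact absurd hc huT₀
        · exact Finset.mem_union.mpr (Or.inl hA)
        · exact absurd hc huT₀
        · exact Finset.mem_union.mpr (Or.inr hB)
      · intro hs c hc
        rcases Finset.mem_insert.mp hc with rfl | hc
        · exact Finset.mem_union.mpr (Or.inl (Finset.mem_insert_self _ _))
        · rcases Finset.mem_union.mp (hs hc) with hA | hB
          · exact Finset.mem_union.mpr (Or.inl (Finset.mem_insert_of_mem hA))
          · exact Finset.mem_union.mpr (Or.inr (Finset.mem_insert_of_mem hB))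
    have c2 : (insert u T₀ ⊆ A ∪ insert u B) ↔ T₀ ⊆ A ∪ B := by
      constructor
      · intro hs c hc
        have := hs (Finset.mem_insert_of_mem hc)
        simp only [Finset.mem_union, Finset.mem_insert] at this
        rcases this with hA | (rfl | hB)
        · exact Finset.mem_union.mpr (Or.inl hA)
        · exact absurd hc huT₀
        · exact Finset.mem_union.mpr (Or.inr hB)
      · intro hs c hc
        rcases Finset.mem_insert.mp hc with rfl | hc
        · exact Finset.mem_union.mpr (Or.inr (Finset.mem_insert_self _ _))
        · rcases Finset.mem_union.mp (hs hc) with hA | hB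
          · exact Finset.mem_union.mpr (Or.inl hA)
          · exact Finset.mem_union.mpr (Or.inr (Finset.mem_insert_of_mem hB))
    have c3 : (insert u T₀ ⊆ insert u A ∪ B) ↔ T₀ ⊆ A ∪ B := by
      constructor
      · intro hs c hc
        have := hs (Finset.mem_insert_of_mem hc)
        simp only [Finset.mem_union, Finset.mem_insert] at this
        rcases this with (rfl | hA) | hB
        · exact absurd hc huT₀
        · exact Finset.mem_union.mpr (Or.inl hA)
        · exact Finset.mem_union.mpr (Or.inr hB)
      · intro hs c hc
        rcases Finset.mem_insert.mp hc with rfl | hc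
        · exact Finset.mem_union.mpr (Or.inl (Finset.mem_insert_self _ _))
        · rcases Finset.mem_union.mp (hs hc) with hA | hB
          · exact Finset.mem_union.mpr (Or.inl (Finset.mem_insert_of_mem hA))
          · exact Finset.mem_union.mpr (Or.inr hB)
    by_cases hT₀ : T₀ ⊆ A ∪ B
    · rw [if_pos (c1.mpr hT₀), if_pos (c2.mpr hT₀), if_pos (c3.mpr hT₀)]
      -- the Venn counts
      have e1 : insert u T₀ \ insert u B = T₀ \ B := by
        rw [Finset.insert_sdiff_of_mem _ (Finset.mem_insert_self u B), Finset.sdiff_insert_of_notMem huT₀]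
      have e2 : insert u T₀ \ insert u A = T₀ \ A := by
        rw [Finset.insert_sdiff_of_mem _ (Finset.mem_insert_self u A), Finset.sdiff_insert_of_notMem huT₀]
      have e3 : insert u T₀ ∩ insert u A ∩ insert u B = insert u (T₀ ∩ A ∩ B) := by
        rw [← Finset.insert_inter_distrib, ← Finset.insert_inter_distrib]
      have e4 : insert u T₀ \ A = insert u (T₀ \ A) := Finset.insert_sdiff_of_notMem _ huA
      have e5 : insert u T₀ \ B = insert u (T₀ \ B) := Finset.insert_sdiff_of_notMem _ huB
      have e6 : insert u T₀ ∩ A ∩ insert u B = T₀ ∩ A ∩ B := by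
        rw [Finset.insert_inter_of_notMem huA]
        exact Finset.inter_insert_of_notMem (fun hu => huA (Finset.mem_inter.mp hu).2)
      have e7 : insert u T₀ ∩ insert u A ∩ B = T₀ ∩ A ∩ B := by
        rw [← Finset.insert_inter_distrib, Finset.insert_inter_of_notMem huB]
      have n3 : u ∉ T₀ ∩ A ∩ B := fun hu => huT₀ (Finset.mem_inter.mp (Finset.mem_inter.mp hu).1).1
      have n4 : u ∉ T₀ \ A := fun hu => huT₀ (Finset.mem_sdiff.mp hu).1
      have n5 : u ∉ T₀ \ B := fun hu => huT₀ (Finset.mem_sdiff.mp hu).1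
      rw [e1, e2, e3, e4, e5, e6, e7, Finset.card_insert_of_notMem n3, Finset.card_insert_of_notMem n4,
        Finset.card_insert_of_notMem n5]
      exact betaSum_succ _ _ _
    · rw [if_neg (fun h' => hT₀ (c1.mp h')), if_neg (fun h' => hT₀ (c2.mp h')),
        if_neg (fun h' => hT₀ (c3.mp h'))]
  · -- `u ∉ T`: all four entries coincide
    have s1 : T \ insert u B = T \ B := Finset.sdiff_insert_of_notMem huT _
    have s2 : T \ insert u A = T \ A := Finset.sdiff_insert_of_notMem huT _
    have s3 : T ∩ insert u A = T ∩ A := Finset.inter_insert_of_notMem huT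
    have n3 : u ∉ T ∩ A := fun hu => huT (Finset.mem_inter.mp hu).1
    have s4 : T ∩ A ∩ insert u B = T ∩ A ∩ B := Finset.inter_insert_of_notMem n3
    have c0 : ∀ X : Finset (Fin h), (T ⊆ insert u X) ↔ T ⊆ X := fun X => Finset.subset_insert_iff_of_notMem huT
    have u1 : insert u A ∪ insert u B = insert u (A ∪ B) := by
      rw [Finset.insert_union, Finset.union_insert, Finset.insert_idem]
    have u2 : A ∪ insert u B = insert u (A ∪ B) := Finset.union_insert _ _ _
    have u3 : insert u A ∪ B = insert u (A ∪ B) := Finset.insert_union _ _ _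
    rw [u1, u2, u3, s1, s2, s3, s4]
    simp only [c0]

/-! ## 2. The no-go theorem -/

/-- **Two parallel edges kill a 0/1 design.**  If the support family has `σ x' = insert u (σ x)`, `σ b' = insert u (σ b)`
with `u ∉ σ x`, `u ∉ σ b`, for four points with `x, x'` both different from `b, b'`, then for every enumeration `uu` of
the rows hitting all subsets of size `≤ 2` (injective or not) the segment-moment matrix at `zoTable σ` has determinant `0`: the rows
`{x,b}, {x',b'}, {x,b'}, {x',b}` are linearly dependent (`+ + − −`). -/
theorem det_zoTable_eq_zero_of_parallel_edges (σ : Fin h → Finset (Fin h)) (x x' b b' u : Fin h)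
    (hx : σ x' = insert u (σ x)) (hux : u ∉ σ x) (hb : σ b' = insert u (σ b)) (hub : u ∉ σ b)
    (hxb : x ≠ b) (hxb' : x ≠ b') (hx'b : x' ≠ b) (hx'b' : x' ≠ b')
    (r : ℕ) (uu : Fin r → Finset (Fin h))
    (hsurj : ∀ S : Finset (Fin h), S.card ≤ 2 → ∃ i, uu i = S) :
    (Matrix.of fun i j : Fin r =>
      ∑ g : (↥(benchCols h r j) → ↥(uu i)), (∏ c : ↥(benchCols h r j), zoTable σ (g c) c) *
        ∏ a : ↥(uu i),
          ((Finset.univ.filter fun c : ↥(benchCols h r j) => g c = a).card.factorial : ℂ)).det = 0 := by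
  classical
  -- `x ≠ x'` and `b ≠ b'` follow from the support hypotheses
  have hxx' : x ≠ x' := by
    rintro rfl; rw [hx] at hux; exact hux (Finset.mem_insert_self _ _)
  have hbb' : b ≠ b' := by
    rintro rfl; rw [hb] at hub; exact hub (Finset.mem_insert_self _ _)
  set M : Matrix (Fin r) (Fin r) ℂ := Matrix.of fun i j : Fin r =>
      ∑ g : (↥(benchCols h r j) → ↥(uu i)), (∏ c : ↥(benchCols h r j), zoTable σ (g c) c) *
        ∏ a : ↥(uu i),
          ((Finset.univ.filter fun c : ↥(benchCols h r j) => g c = a).card.factorial : ℂ) with hM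
  -- the four rows
  have card2 : ∀ p q : Fin h, p ≠ q → ({p, q} : Finset (Fin h)).card ≤ 2 := fun p q hpq => by
    rw [Finset.card_pair hpq]
  obtain ⟨i₁, hi₁⟩ := hsurj {x, b} (card2 x b hxb)
  obtain ⟨i₂, hi₂⟩ := hsurj {x', b'} (card2 x' b' hx'b')
  obtain ⟨i₃, hi₃⟩ := hsurj {x, b'} (card2 x b' hxb')
  obtain ⟨i₄, hi₄⟩ := hsurj {x', b} (card2 x' b hx'b)
  -- the pair rows in closed form
  have rowval : ∀ (i : Fin r) (p q : Fin h), p ≠ q → uu i = {p, q} → ∀ j : Fin r,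
      M i j = (zoPairEntry (σ p) (σ q) (benchCols h r j) : ℂ) := by
    intro i p q hpq hi j
    simp only [hM, Matrix.of_apply]
    rw [hi, segSum_pair_zoTable σ p q hpq (benchCols h r j)]
    unfold zoPairEntry
    split_ifs <;> simp
  -- distinctness of the four row indices
  have pair_ne : ∀ p q p' q' : Fin h, ({p, q} : Finset (Fin h)) = {p', q'} → (p = p' ∧ q = q') ∨ (p = q' ∧ q = p') := by
    intro p q p' q' e
    have hp : p ∈ ({p', q'} : Finset (Fin h)) := by rw [← e]; simp
    have hq : q ∈ ({p', q'} : Finset (Fin h)) := by rw [← e]; simp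
    have hp' : p' ∈ ({p, q} : Finset (Fin h)) := by rw [e]; simp
    have hq' : q' ∈ ({p, q} : Finset (Fin h)) := by rw [e]; simp
    simp only [Finset.mem_insert, Finset.mem_singleton] at hp hq hp' hq'
    rcases hp with rfl | rfl
    · rcases hq with rfl | rfl
      · rcases hq' with h1 | h1 <;> exact Or.inl ⟨rfl, h1.symm⟩
      · exact Or.inl ⟨rfl, rfl⟩
    · rcases hq with rfl | rfl
      · exact Or.inr ⟨rfl, rfl⟩
      · rcases hp' with h1 | h1 <;> exact Or.inr ⟨rfl, h1.symm⟩
  have n12 : i₁ ≠ i₂ := by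
    intro e; have := pair_ne x b x' b' (by rw [← hi₁, ← hi₂, e])
    rcases this with ⟨h1, _⟩ | ⟨h1, _⟩
    · exact hxx' h1
    · exact hxb' h1
  have n13 : i₁ ≠ i₃ := by
    intro e; have := pair_ne x b x b' (by rw [← hi₁, ← hi₃, e])
    rcases this with ⟨_, h2⟩ | ⟨h1, _⟩
    · exact hbb' h2
    · exact hxb' h1
  have n14 : i₁ ≠ i₄ := by
    intro e; have := pair_ne x b x' b (by rw [← hi₁, ← hi₄, e])
    rcases this with ⟨h1, _⟩ | ⟨h1, _⟩
    · exact hxx' h1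
    · exact hxb h1
  have n23 : i₂ ≠ i₃ := by
    intro e; have := pair_ne x' b' x b' (by rw [← hi₂, ← hi₃, e])
    rcases this with ⟨h1, _⟩ | ⟨h1, _⟩
    · exact hxx' h1.symm
    · exact hx'b' h1
  have n24 : i₂ ≠ i₄ := by
    intro e; have := pair_ne x' b' x' b (by rw [← hi₂, ← hi₄, e])
    rcases this with ⟨_, h2⟩ | ⟨h1, _⟩
    · exact hbb' h2.symm
    · exact hx'b h1
  have n34 : i₃ ≠ i₄ := by
    intro e; have := pair_ne x b' x' b (by rw [← hi₃, ← hi₄, e])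
    rcases this with ⟨h1, _⟩ | ⟨h1, _⟩
    · exact hxx' h1
    · exact hxb h1
  -- the dependency vector
  let v : Fin r → ℂ := Pi.single i₁ 1 + Pi.single i₂ 1 - Pi.single i₃ 1 - Pi.single i₄ 1
  have hv0 : v ≠ 0 := by
    intro hv
    have := congr_fun hv i₁
    simp only [v, Pi.add_apply, Pi.sub_apply, Pi.single_eq_same, Pi.single_eq_of_ne n12, Pi.single_eq_of_ne n13,
      Pi.single_eq_of_ne n14, Pi.zero_apply] at this
    norm_num at this
  have hvM : Matrix.vecMul v M = 0 := by
    funext j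
    simp only [v, Matrix.add_vecMul, Matrix.sub_vecMul, Matrix.single_one_vecMul, Pi.add_apply, Pi.sub_apply,
      Matrix.row_apply, Pi.zero_apply]
    rw [rowval i₁ x b hxb hi₁ j, rowval i₂ x' b' hx'b' hi₂ j, rowval i₃ x b' hxb' hi₃ j,
      rowval i₄ x' b hx'b hi₄ j, hx, hb]
    have key := zoPairEntry_parallel (σ x) (σ b) (benchCols h r j) u hux hub
    have key' : (zoPairEntry (σ x) (σ b) (benchCols h r j) : ℂ) +
        (zoPairEntry (insert u (σ x)) (insert u (σ b)) (benchCols h r j) : ℂ) =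
        (zoPairEntry (σ x) (insert u (σ b)) (benchCols h r j) : ℂ) +
          (zoPairEntry (insert u (σ x)) (σ b) (benchCols h r j) : ℂ) := by
      exact_mod_cast key
    linear_combination key'
  exact (Matrix.exists_vecMul_eq_zero_iff).mp ⟨v, hv0, hvM⟩

end Summit.ValiantsHypothesis.ValiantsHypothesis.Theorems.BarrierLever.ChowBenchmarkZeroOne
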